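import Mathlib

/-!
# PneNP / OverlapGapAlgebra — crux `SolvableImpliesStableSection` (stmt-PneNP-2463):
# the MONOTONE REPAIR block (15/·) — the repair section is a local rule

Support for crux `stmt-PneNP-2463` (`Summit.PneNP.PneNP.Theses.OverlapGapAlgebra.SolvableImpliesStableSection`):
the f-free block "bounded-round monotone repair gives stable sections up to `α ≤ 2^k/(4k)`".
The values of MONOTONE REPAIR (`val`, specified by `hval0`/`hvalS` as in `…MonotoneRepairDynamics`)
after `t` rounds at a variable `v` are determined by the labelled clauses that `v` sees within radius
`t` (co-occurrence walks with stutter, the locality notion `hloc` of `shwRad_hamming_le`): a flip of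
`v` at round `t` is decided by the clauses containing `v` and the round-`t` values of their variables.

* `sissR_sees_of_reach` — a co-occurrence walk of length `q ≤ R` shows its endpoint's clauses
  within radius `R`;
* `sissR_val_transfer` — if `Φ`, `Φ'` agree on every clause `v` sees within radius `R` (in either
  instance), then `val t Φ w = val t Φ' w` for every `w` reached from `v` in `q` steps, `q + t ≤ R`;
* `sissR_local` — hence `val R Φ v = val R Φ' v`: the section `Φ ↦ val R Φ` is a radius-`R`
  local rule.
No definitions (all objects are hypotheses); axioms `propext`, `Classical.choice`, `Quot.sound`.
-/

set_option linter.dupNamespace false -- `Summit.PneNP.PneNP.…`: summit = sub-problem (D-0017)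

namespace Summit.PneNP.PneNP.Theorems

open Finset
open scoped Classical

section Local

variable {m k n : ℕ}

/-- A co-occurrence walk of length `q ≤ R` from `v` to a variable of clause `i` shows that `v` sees
`i` within radius `R` (pad with stutter steps). -/
theorem sissR_sees_of_reach (Φ : (Fin m → Fin k → Fin n × Bool)) (v : Fin n) (i : Fin m)
    (j : Fin k) (q R : ℕ) (hqR : q ≤ R) (p : ℕ → Fin n) (hp0 : p 0 = v) (hpq : p q = (Φ i j).1)
    (hstep : ∀ s, s < q → (p s = p (s + 1) ∨
      ∃ i' : Fin m, ∃ j₁ j₂ : Fin k, (Φ i' j₁).1 = p s ∧ (Φ i' j₂).1 = p (s + 1))) :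
    ∃ j : Fin k, ∃ p : ℕ → Fin n, p 0 = v ∧ p R = (Φ i j).1 ∧ ∀ s, s < R → (p s = p (s + 1) ∨
      ∃ i' : Fin m, ∃ j₁ j₂ : Fin k, (Φ i' j₁).1 = p s ∧ (Φ i' j₂).1 = p (s + 1)) := by
  refine ⟨j, fun s => p (min s q), by dsimp only; rw [Nat.zero_min, hp0],
    by dsimp only; rw [min_eq_right hqR, hpq], ?_⟩
  intro s _
  dsimp only
  rcases Nat.lt_or_ge s q with hsq | hsq
  · rw [min_eq_left hsq.le, min_eq_left (Nat.succ_le_of_lt hsq)]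
    exact hstep s hsq
  · left
    rw [min_eq_right hsq, min_eq_right (Nat.le_succ_of_le hsq)]

/-- **Locality of the repair values, walk form.** If `Φ` and `Φ'` agree on every clause that `v` sees
within radius `R` (in either instance), then for every round `t`, every length `q` with `q + t ≤ R` and
every variable `w` reached from `v` by a co-occurrence walk of length `q` in `Φ`:
`val t Φ w = val t Φ' w`. -/
theorem sissR_val_transfer (val : ℕ → (Fin m → Fin k → Fin n × Bool) → Fin n → Bool)
    (hval0 : ∀ (Φ : (Fin m → Fin k → Fin n × Bool)) (v : Fin n), val 0 Φ v = true)
    (hvalS : ∀ (t : ℕ) (Φ : (Fin m → Fin k → Fin n × Bool)) (v : Fin n), val (t + 1) Φ v = true ↔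
      (val t Φ v = true ∧ ¬ (∃ ii : Fin m, (∀ jj : Fin k, val t Φ (Φ ii jj).1 ≠ (Φ ii jj).2) ∧
        ∃ jf : Fin k, (Φ ii jf).2 = false ∧ (∀ j' : Fin k, j' < jf → (Φ ii j').2 = true) ∧ (Φ ii jf).1 = v)))
    (R : ℕ) (Φ Φ' : (Fin m → Fin k → Fin n × Bool)) (v : Fin n)
    (H : ∀ i : Fin m,
      ((∃ j : Fin k, ∃ p : ℕ → Fin n, p 0 = v ∧ p R = (Φ i j).1 ∧ ∀ s, s < R → (p s = p (s + 1) ∨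
          ∃ i' : Fin m, ∃ j₁ j₂ : Fin k, (Φ i' j₁).1 = p s ∧ (Φ i' j₂).1 = p (s + 1))) ∨
       (∃ j : Fin k, ∃ p : ℕ → Fin n, p 0 = v ∧ p R = (Φ' i j).1 ∧ ∀ s, s < R → (p s = p (s + 1) ∨
          ∃ i' : Fin m, ∃ j₁ j₂ : Fin k, (Φ' i' j₁).1 = p s ∧ (Φ' i' j₂).1 = p (s + 1)))) →
      Φ i = Φ' i) :
    ∀ (t : ℕ) (w : Fin n) (q : ℕ), q + t ≤ R →
      (∃ p : ℕ → Fin n, p 0 = v ∧ p q = w ∧ ∀ s, s < q → (p s = p (s + 1) ∨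
          ∃ i' : Fin m, ∃ j₁ j₂ : Fin k, (Φ i' j₁).1 = p s ∧ (Φ i' j₂).1 = p (s + 1))) →
      val t Φ w = val t Φ' w := by
  -- the symmetric agreement hypothesis
  have H' : ∀ i : Fin m,
      ((∃ j : Fin k, ∃ p : ℕ → Fin n, p 0 = v ∧ p R = (Φ' i j).1 ∧ ∀ s, s < R → (p s = p (s + 1) ∨
          ∃ i' : Fin m, ∃ j₁ j₂ : Fin k, (Φ' i' j₁).1 = p s ∧ (Φ' i' j₂).1 = p (s + 1))) ∨
       (∃ j : Fin k, ∃ p : ℕ → Fin n, p 0 = v ∧ p R = (Φ i j).1 ∧ ∀ s, s < R → (p s = p (s + 1) ∨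
          ∃ i' : Fin m, ∃ j₁ j₂ : Fin k, (Φ i' j₁).1 = p s ∧ (Φ i' j₂).1 = p (s + 1)))) →
      Φ' i = Φ i := fun i h => (H i h.symm).symm
  intro t
  induction t with
  | zero =>
    intro w q _ _
    rw [hval0, hval0]
  | succ t ih =>
    intro w q hqt hreach
    obtain ⟨p, hp0, hpq, hpath⟩ := hreach
    -- a clause containing `w` (in either instance) agrees, and all its variables satisfy the IH
    have hclause : ∀ (i : Fin m) (jw : Fin k), ((Φ i jw).1 = w ∨ (Φ' i jw).1 = w) →
        Φ i = Φ' i ∧ ∀ j : Fin k, val t Φ (Φ i j).1 = val t Φ' (Φ i j).1 := by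
      intro i jw hw
      have hi : Φ i = Φ' i := by
        rcases hw with hw | hw
        · exact H i (Or.inl (sissR_sees_of_reach Φ v i jw q R (by omega) p hp0 (by rw [hpq, hw]) hpath))
        · refine (H' i (Or.inl (sissR_sees_of_reach Φ' v i jw q R (by omega) p hp0 (by rw [hpq, hw])
            fun s hs => ?_))).symm
          rcases hpath s hs with h | ⟨i', j₁, j₂, h₁, h₂⟩
          · exact Or.inl h
          · -- rewrite the co-occurrence step into `Φ'` through a clause seen in `Φ`
            have hi' : Φ i' = Φ' i' :=
              H i' (Or.inl (sissR_sees_of_reach Φ v i' j₁ s R (by omega) p hp0 h₁.symm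
                fun s' hs' => hpath s' (by omega)))
            exact Or.inr ⟨i', j₁, j₂, by rw [← hi']; exact h₁, by rw [← hi']; exact h₂⟩
      refine ⟨hi, fun j => ih (Φ i j).1 (q + 1) (by omega) ?_⟩
      -- extend the walk by one step inside clause `i`
      have hwi : (Φ i jw).1 = w := by
        rcases hw with hw | hw
        · exact hw
        · rw [hi]; exact hw
      refine ⟨fun s => if s ≤ q then p s else (Φ i j).1, by
          dsimp only; rw [if_pos (Nat.zero_le q), hp0], by dsimp only; rw [if_neg (by omega)], ?_⟩
      intro s hs
      dsimp only
      rcases Nat.lt_or_ge s q with hsq | hsq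
      · rw [if_pos hsq.le, if_pos (Nat.succ_le_of_lt hsq)]
        exact hpath s hsq
      · have hs' : s = q := by omega
        subst hs'
        right
        refine ⟨i, jw, j, ?_, ?_⟩
        · rw [if_pos le_rfl, hpq]; exact hwi
        · rw [if_neg (by omega)]
    -- the flip events at `w` agree
    have hflip : ((∃ ii : Fin m, (∀ jj : Fin k, val t Φ (Φ ii jj).1 ≠ (Φ ii jj).2) ∧
        ∃ jf : Fin k, (Φ ii jf).2 = false ∧ (∀ j' : Fin k, j' < jf → (Φ ii j').2 = true) ∧ (Φ ii jf).1 = w)) ↔ ((∃ ii : Fin m, (∀ jj : Fin k, val t Φ' (Φ' ii jj).1 ≠ (Φ' ii jj).2) ∧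
        ∃ jf : Fin k, (Φ' ii jf).2 = false ∧ (∀ j' : Fin k, j' < jf → (Φ' ii j').2 = true) ∧ (Φ' ii jf).1 = w)) := by
      constructor
      · rintro ⟨i, hviol, jf, hjf, hlt, hvar⟩
        obtain ⟨hi, hvals⟩ := hclause i jf (Or.inl hvar)
        refine ⟨i, fun jj => ?_, jf, by rw [← hi]; exact hjf, fun j' hj' => by rw [← hi]; exact hlt j' hj',
          by rw [← hi]; exact hvar⟩
        rw [← hi, ← hvals jj]
        exact hviol jj
      · rintro ⟨i, hviol, jf, hjf, hlt, hvar⟩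
        obtain ⟨hi, hvals⟩ := hclause i jf (Or.inr hvar)
        refine ⟨i, fun jj => ?_, jf, by rw [hi]; exact hjf, fun j' hj' => by rw [hi]; exact hlt j' hj',
          by rw [hi]; exact hvar⟩
        rw [hvals jj, hi]
        exact hviol jj
    have hval : val t Φ w = val t Φ' w := ih w q (by omega) ⟨p, hp0, hpq, hpath⟩
    -- conclude through the step specification
    rw [Bool.eq_iff_iff, hvalS, hvalS, hval, hflip]

/-- **The repair section is a radius-`R` local rule.** If `Φ` and `Φ'` agree on every clause that
`v` sees within radius `R` (hypothesis shape `hloc` of `shwRad_hamming_le`), then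
`val R Φ v = val R Φ' v`. -/
theorem sissR_local (val : ℕ → (Fin m → Fin k → Fin n × Bool) → Fin n → Bool)
    (hval0 : ∀ (Φ : (Fin m → Fin k → Fin n × Bool)) (v : Fin n), val 0 Φ v = true)
    (hvalS : ∀ (t : ℕ) (Φ : (Fin m → Fin k → Fin n × Bool)) (v : Fin n), val (t + 1) Φ v = true ↔
      (val t Φ v = true ∧ ¬ (∃ ii : Fin m, (∀ jj : Fin k, val t Φ (Φ ii jj).1 ≠ (Φ ii jj).2) ∧
        ∃ jf : Fin k, (Φ ii jf).2 = false ∧ (∀ j' : Fin k, j' < jf → (Φ ii j').2 = true) ∧ (Φ ii jf).1 = v)))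
    (R : ℕ) (Φ Φ' : (Fin m → Fin k → Fin n × Bool)) (v : Fin n)
    (H : ∀ i : Fin m,
      ((∃ j : Fin k, ∃ p : ℕ → Fin n, p 0 = v ∧ p R = (Φ i j).1 ∧ ∀ s, s < R → (p s = p (s + 1) ∨
          ∃ i' : Fin m, ∃ j₁ j₂ : Fin k, (Φ i' j₁).1 = p s ∧ (Φ i' j₂).1 = p (s + 1))) ∨
       (∃ j : Fin k, ∃ p : ℕ → Fin n, p 0 = v ∧ p R = (Φ' i j).1 ∧ ∀ s, s < R → (p s = p (s + 1) ∨
          ∃ i' : Fin m, ∃ j₁ j₂ : Fin k, (Φ' i' j₁).1 = p s ∧ (Φ' i' j₂).1 = p (s + 1)))) →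
      Φ i = Φ' i) :
    val R Φ v = val R Φ' v :=
  sissR_val_transfer val hval0 hvalS R Φ Φ' v H R v 0 (by omega)
    ⟨fun _ => v, rfl, rfl, fun s hs => absurd hs (Nat.not_lt_zero s)⟩

end Local

end Summit.PneNP.PneNP.Theorems
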